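import Summits.BirchSwinnertonDyer.BirchSwinnertonDyer.Theorems.EisensteinPrimesGoodLatticeBDPValuePublishedFactsOfTextbook
import Summits.BirchSwinnertonDyer.BirchSwinnertonDyer.Theorems.EisensteinPrimesIndexInputsShellOfTateTC
import Summits.BirchSwinnertonDyer.BirchSwinnertonDyer.Theorems.EisensteinPrimesIndexInputsH2OfTateTC
import Literature.NumberTheory.IwasawaTheory.Greenberg2006.GlobalEulerPoincareCorankOfTateTC
import HarnessLib

/-!
# Route `EisensteinPrimes` (rung K5), crux 2 `GoodLatticeBDPValue` (stmt-BirchSwinnertonDyer-19032), line `halves` v28: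
# the Greenberg-type published inputs and the closed stub 2a-I `indexInputs` from Greenberg 2016 Prop. 2.6.3, Milne ADT I
# Thm. 5.1 and Harari Thm. 17.13 (a), BOTH AT TOTALLY COMPLEX FIELDS ONLY

Cell `bsd-eis`, seat `bsd-line-x1-p1` LEAD g8, lane «T28 / TATE RE-PLUMB» (helper, `--supports`). The `TC` twin of width seat
w2 gen 6's `GoodLatticeBDPValuePublishedFactsOfTextbook` (p660402), which takes Poitou–Tate 17.13 (a) quantified over EVERY number
field because it derives Greenberg 2006 Prop. 3.2 (`prop32_cohomology_isCofinitelyGenerated`, every field, every degree) from it.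
After the T28 re-typing (files `…OfTate`: the line reads Prop. 3.2 in degrees `≤ 2` only, and at the imaginary quadratic field only, where it follows from Tate's formula at that field —
`Greenberg2006.prop32_global_le_two_of_tate_tc`, files `…OfTateTC`; the local clause is unconditional) Prop. 3.2 is no longer an
input, and the remaining uses of 17.13 (a) are at totally complex fields: Greenberg 2006 Prop. 4.1 is TYPED totally imaginary
(`Greenberg2006.prop41_of_tate_of_poitouTate_three_le_tc`), `cd_p(G_{K,Σ}) ≤ 2` and the `H²` bookkeeping are read at the imaginary
quadratic `K`.  So:

* `publishedFactsGreenberg_of_textbook_tc` — SEVEN of v22's eight Greenberg-type conjuncts (all but Prop. 3.2) from Greenberg 2016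
  Prop. 4.1.1, Milne I 5.1 and Harari 17.13 (a), both ∀ L totally complex, BCGKPST §3.3 and (T4);
* `indexInputs_of_textbook_tc` — the closed stub 2a-I (`GoodLatticeBDPValueIndexStubs.indexInputs`, registered statement VERBATIM
  from `∀ W` on) from Greenberg 2016 Prop. 2.6.3, Milne I 5.1 and Harari 17.13 (a), both at totally complex fields: same two-line proof as
  p660402's `indexInputs_of_textbook` on the re-typed `IndexInputsShell.indexInputs_of_H2_ofTateTC` / `IndexInputsH2.natCard_H2_conjunct_ofTateTC`.

USE: the v28 skeleton's `stub_publishedFactsGreenberg := prop411 ∧ (∀ L [IsTotallyComplex L], tateEPC L)` (Milne I 5.1 at totally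
complex fields = the end-theorem shape of lane TATE-EPC-TC), the Poitou–Tate input `ha` being SUPPLIED BY THE TREE THEOREM
`GaloisCohomology.forall_poitouTate_restricted_three_le_of_isTotallyComplex` (lane PT3-TC, w8 gen 9 (A5), p681302:
`RestrictedRamificationCdTwoOfH3Mu`, `RestrictedRamificationPoitouTateThreeLeOfCdTwo`, `…TotallyComplex`).  Theorems only; no definition, no named fact, no `sorry`. HONEST FRAMING:
conditional on the PUBLISHED named facts carried as hypotheses; closes nothing by itself; no summit statement / BSD / the crux proved.
[cite: Greenberg2016Selmer, Prop. 4.1.1, Prop. 4.2.2, Prop. 2.6.3] [cite: Greenberg2006, §5 A, Prop. 4.1, Prop. 4.2, Prop. 3.2]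
[cite: MilneADT2006, I Thm. 5.1 (p. 67)] [cite: Harari2020, Thm. 17.13 (a), Cor. 17.14, Cor. 17.17] [cite: BleherEtAl2020, §3.3]
[cite: KellerYin2024, Prop. 1.3.2 and §1.4] [cite: PollackWeston2011, Prop. A.2]
-/

noncomputable section

open scoped Classical

open PowerSeries WeierstrassCurve NumberField IsDedekindDomain Field
  Literature.NumberTheory.GaloisRepresentations Literature.NumberTheory.EllipticCurves.GreenbergVatsal2000
  Literature.NumberTheory.EllipticCurves Literature.NumberTheory.EllipticCurves.ModularForms
  Literature.NumberTheory.EllipticCurves.Rank1Residual Literature.NumberTheory.EllipticCurves.Castella2018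
  Literature.NumberTheory.EllipticCurves.GreenbergSelmer Literature.NumberTheory.QuadraticFields
  Literature.NumberTheory.EllipticCurves.CastellaGrossiLeeSkinner2022
  Literature.NumberTheory.EllipticCurves.KellerYin2024 Literature.NumberTheory.EllipticCurves.IwasawaAlgebra
  Literature.NumberTheory.EllipticCurves.BCGKPST2020
open Literature.NumberTheory.IwasawaTheory Literature.NumberTheory.IwasawaTheory.Greenberg2016
  Literature.NumberTheory.IwasawaTheory.Greenberg2006 Literature.NumberTheory.GaloisCohomology
open Summit.BirchSwinnertonDyer.Rank1Residual.X2.ResidualDevissageModules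
  Summit.BirchSwinnertonDyer.BirchSwinnertonDyer.Theorems
namespace Summit.BirchSwinnertonDyer.BirchSwinnertonDyer.Theorems.GoodLatticeBDPValuePublishedFactsOfTextbookTC

open GoodLatticeBDPValuePublishedFactsOfTextbook

/-! ### §1. Seven Greenberg-type conjuncts from five hypotheses, Poitou–Tate at totally complex fields only -/

/-- **v22's stub-4 conjuncts WITHOUT Greenberg 2006 Prop. 3.2 (seven of eight, token for token) from FIVE hypotheses**:
Greenberg 2016 Prop. 4.1.1 (`h411`), Tate's global Euler–Poincaré characteristic AT TOTALLY COMPLEX FIELDS (`hT`, Milne ADT I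
Thm. 5.1), Poitou–Tate in degrees `≥ 3` AT TOTALLY COMPLEX FIELDS (`ha`, Harari Thm. 17.13 (a) / Cor. 17.14), BCGKPST 2020 §3.3
(`h33`) and weak Leopoldt above the cyclotomic line in the open-subgroup form (`hT4`). Props. 4.2.2 / §5 A / 4.2 are TREE THEOREMS;
Prop. 4.1 (typed totally imaginary) is `Greenberg2006.prop41_of_tate_of_poitouTate_three_le_of_isTotallyComplex hT ha`.
[cite: Greenberg2016Selmer, Prop. 4.1.1, Prop. 4.2.2] [cite: Greenberg2006, §5 A, Prop. 4.1, Prop. 4.2]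
[cite: MilneADT2006, I Thm. 5.1 (p. 67)] [cite: Harari2020, Thm. 17.13 (a), Cor. 17.14] [cite: BleherEtAl2020, §3.3 Thm. 3.3.1]
[cite: NguyenQuangDo1984, Thm. 2.2] -/
theorem publishedFactsGreenberg_of_textbook_tc (h411 : prop411_selmer_isAlmostDivisible)
    (hT : ∀ (L : Type) [Field L] [NumberField L] [IsTotallyComplex L], tateGlobalEulerPoincareCharacteristic L)
    (ha : ∀ (L : Type) [Field L] [NumberField L] [IsTotallyComplex L], poitouTate_restricted_three_le L)
    (h33 : BCGKPST2020.sec33_rubin_unrSelmer₂_finite_torsion)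
    (hT4 : weakLeopoldt_H2_subsingleton_above_cyclotomic_of_isOpen) :
    prop411_selmer_isAlmostDivisible ∧ prop422_localCohomology_isAlmostDivisible ∧
      sec5A_localH2_subsingleton_of_LOC1 ∧ prop41_globalEulerPoincareCorank ∧
      prop42_localEulerPoincareCorank ∧
      BCGKPST2020.sec33_rubin_unrSelmer₂_finite_torsion ∧
      weakLeopoldt_H2_subsingleton_above_cyclotomic_of_isOpen :=
  ⟨h411, prop422_localCohomology_isAlmostDivisible_holds, sec5A_localH2_subsingleton_of_LOC1_holds,
    prop41_of_tate_of_poitouTate_three_le_of_isTotallyComplex hT ha, prop42_localEulerPoincareCorank_holds, h33, hT4⟩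

/-! ### §2. `cd_p(G_{K,S}) ≤ 2` at the imaginary quadratic field from 17.13 (a) at totally complex fields -/

/-- **`cd_p(G_{K,S}) ≤ 2` at an imaginary quadratic `K` from Harari Thm. 17.13 (a) AT TOTALLY COMPLEX FIELDS** (an imaginary
quadratic field is totally complex). [cite: Harari2020, Thm. 17.13 (a), Cor. 17.14 (p. 295)] [cite: NeukirchSchmidtWingberg2008, (8.3.18)] -/
theorem groupCdLE_two_of_poitouTate_tc_of_isImaginaryQuadratic {K : Type} [Field K] [NumberField K]
    (ha : ∀ (L : Type) [Field L] [NumberField L] [IsTotallyComplex L], poitouTate_restricted_three_le L)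
    (hK : IsImaginaryQuadratic K) : groupCdLE_two_galoisGroupUnramifiedOutside K :=
  haveI : IsTotallyComplex K := hK.2
  groupCdLE_two_galoisGroupUnramifiedOutside_of_poitouTate (ha K)

/-! ### §3. The closed stub 2a-I `indexInputs` from Prop. 2.6.3, Milne I 5.1 and 17.13 (a) at totally complex fields -/

/-- **`GoodLatticeBDPValueIndexStubs.indexInputs` (closed stub 2a-I of halves v20.2) from Greenberg 2016 Prop. 2.6.3, Tate's global
Euler characteristic and Poitou–Tate 17.13 (a), BOTH AT TOTALLY COMPLEX FIELDS only**: the statement from `∀ W` on is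
the registered one VERBATIM (= p660402's `indexInputs_of_textbook` with the second and third antecedents restricted to `[IsTotallyComplex L]`);
proof: Greenberg 2006 Prop. 4.1 from `prop41_of_tate_of_poitouTate_three_le_of_isTotallyComplex`, Props. 4.2 / §5 A tree theorems, Prop. 3.2 no longer
an input (T28b re-typing: `IndexInputsShell.indexInputs_of_H2_ofTateTC`, `IndexInputsH2.natCard_H2_conjunct_ofTateTC` read Tate's
formula in degrees `≤ 2` at the imaginary quadratic `K`), `cd_p ≤ 2` at the imaginary quadratic `K` (§2).
[cite: KellerYin2024, Prop. 1.3.2 and §1.4 (arXiv:2402.12781v2 TeX L700–760, L1178–1330)] [cite: PollackWeston2011, Prop. A.2]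
[cite: Greenberg2016Selmer, Prop. 2.6.3] [cite: MilneADT2006, I Thm. 5.1] [cite: Harari2020, Thm. 17.13 (a), Cor. 17.14]
[cite: Greenberg2006, Props. 3.2, 4.1, 4.2, §5 A] -/
theorem indexInputs_of_textbook_tc :
    prop263_sur_of_crk →
    (∀ (L : Type) [Field L] [NumberField L] [IsTotallyComplex L], tateGlobalEulerPoincareCharacteristic L) →
    (∀ (L : Type) [Field L] [NumberField L] [IsTotallyComplex L], poitouTate_restricted_three_le L) →
    ∀ (W : WeierstrassCurve ℚ) [W.IsElliptic] [W.IsGloballyMinimal] (p : ℕ) [Fact p.Prime],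
      2 < p → Good W p → Red W p → Anom W p →
      (∀ Φ : AddSubgroup (geomTorsion W (p : ℤ)), IsRationalLine W p Φ → ¬ LineUnramifiedAt W p Φ) →
      ∀ (K : Type) [Field K] [NumberField K], IsImaginaryQuadratic K →
        SatisfiesHeegnerHypothesis (W.conductorNorm ℤ) K → SatisfiesHeegnerHypothesis p K →
        (∀ Q : (W.baseChange K).toAffine.Point, p • Q = 0 → Q = 0) →
      ∀ (ι : K →+* ℚ_[p]) (v vbar : HeightOneSpectrum (𝓞 K)),
        (∀ x : 𝓞 K, x ∈ v.asIdeal ↔ ‖ι (x : K)‖ < 1) →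
        ((p : ℕ) : 𝓞 K) ∈ vbar.asIdeal → vbar ≠ v →
      ∀ (κ : ZpExtension K p), κ.IsAnticyclotomic →
      ∀ (γ : absoluteGaloisGroup K) [Fact (κ.IsTopGenerator γ)],
      ∀ (θsub θquot : FramedGaloisRep K (padicCoeffIntegers (∅ : Set (PadicAlgCl p))) 1),
        IsResidualPairOver (W.baseChange K) p θsub θquot →
      ∀ (Sf : Finset (HeightOneSpectrum (𝓞 K))),
        (∀ w : HeightOneSpectrum (𝓞 K), w ∈ Sf ↔ ((W.conductorNorm ℤ : ℤ) : 𝓞 K) ∈ w.asIdeal) →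
      Module.Finite (IwasawaAlgebra p) (AcSelmer.XAc (W.baseChange K) p κ vbar (↑Sf : Set (HeightOneSpectrum (𝓞 K))) γ) →
      Module.IsTorsion (IwasawaAlgebra p) (AcSelmer.XAc (W.baseChange K) p κ vbar (↑Sf : Set (HeightOneSpectrum (𝓞 K))) γ) →
      muInvariant p (AcSelmer.XAc (W.baseChange K) p κ vbar (↑Sf : Set (HeightOneSpectrum (𝓞 K))) γ) = 0 →
      (∀ D : DatumDualData κ γ (charModule ∅ θsub)
          (AcSelmer.bdpData (charModule ∅ θsub) p vbar) (↑Sf : Set (HeightOneSpectrum (𝓞 K))),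
        Module.Finite (IwasawaAlgebra p) D.X ∧ Module.IsTorsion (IwasawaAlgebra p) D.X ∧ muInvariant p D.X = 0) →
      (∀ D : DatumDualData κ γ (charModule ∅ θquot)
          (AcSelmer.bdpData (charModule ∅ θquot) p vbar) (↑Sf : Set (HeightOneSpectrum (𝓞 K))),
        Module.Finite (IwasawaAlgebra p) D.X ∧ Module.IsTorsion (IwasawaAlgebra p) D.X ∧ muInvariant p D.X = 0) →
      ∃ (c : ℕ) (τ : ℕ → absoluteGaloisGroup K)
        (Φ : StableSubgroup (absoluteGaloisGroup K) ↥((W.baseChange K).geomTorsion (p : ℤ)))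
        (j₁ : Φ.Sub →+ charModule ∅ θsub) (j₃ : Φ.Quot →+ charModule ∅ θquot)
        (hj₁ : ∀ (g : absoluteGaloisGroup K) (a : Φ.Sub), j₁ (g • a) = g • j₁ a)
        (hj₃ : ∀ (g : absoluteGaloisGroup K) (a : Φ.Quot), j₃ (g • a) = g • j₃ a),
        -- (R) representatives
        (∀ i : ℕ, κ (τ i) = Multiplicative.ofAdd ((i : ℕ) : ℤ_[p])) ∧
        (∀ i j : ℕ, i < p ^ c → j < p ^ c → i ≠ j → ∀ δ ∈ decomp vbar,
          Multiplicative.ofAdd ((j : ℕ) : ℤ_[p]) ≠ Multiplicative.ofAdd ((i : ℕ) : ℤ_[p]) * κ δ) ∧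
        (∀ x : subgroupH1 κ.kerSubgroup (charModule ∅ θsub),
          (∀ i, i < p ^ c → resOfLe (charModule ∅ θsub) (inf_le_left : κ.kerSubgroup ⊓ decomp vbar ≤ κ.kerSubgroup) (conjH1 κ.kerSubgroup (charModule ∅ θsub) (τ i) x) = 0) →
            ∀ σ : absoluteGaloisGroup K, resOfLe (charModule ∅ θsub) (inf_le_left : κ.kerSubgroup ⊓ decomp vbar ≤ κ.kerSubgroup) (conjH1 κ.kerSubgroup (charModule ∅ θsub) σ x) = 0) ∧
        (∀ x : subgroupH1 κ.kerSubgroup ↥((W.baseChange K).geomPrimaryTorsion p),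
          (∀ i, i < p ^ c → resOfLe ↥((W.baseChange K).geomPrimaryTorsion p) (inf_le_left : κ.kerSubgroup ⊓ decomp vbar ≤ κ.kerSubgroup) (conjH1 κ.kerSubgroup ↥((W.baseChange K).geomPrimaryTorsion p) (τ i) x) = 0) →
            ∀ σ : absoluteGaloisGroup K, resOfLe ↥((W.baseChange K).geomPrimaryTorsion p) (inf_le_left : κ.kerSubgroup ⊓ decomp vbar ≤ κ.kerSubgroup) (conjH1 κ.kerSubgroup ↥((W.baseChange K).geomPrimaryTorsion p) σ x) = 0) ∧
        (∀ x : subgroupH1 κ.kerSubgroup (charModule ∅ θquot),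
          (∀ i, i < p ^ c → resOfLe (charModule ∅ θquot) (inf_le_left : κ.kerSubgroup ⊓ decomp vbar ≤ κ.kerSubgroup) (conjH1 κ.kerSubgroup (charModule ∅ θquot) (τ i) x) = 0) →
            ∀ σ : absoluteGaloisGroup K, resOfLe (charModule ∅ θquot) (inf_le_left : κ.kerSubgroup ⊓ decomp vbar ≤ κ.kerSubgroup) (conjH1 κ.kerSubgroup (charModule ∅ θquot) σ x) = 0) ∧
        -- the Kummer embeddings
        Function.Injective j₁ ∧ Function.Injective j₃ ∧
        (∀ x : charModule ∅ θsub, x ∈ j₁.range ↔ p • x = 0) ∧ (∀ x : charModule ∅ θquot, x ∈ j₃.range ↔ p • x = 0) ∧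
        (∀ x : ↥((W.baseChange K).geomPrimaryTorsion p), x ∈ (AddSubgroup.inclusion (geomTorsion_le_geomPrimaryTorsion (W.baseChange K) p)).range ↔ p • x = 0) ∧
        (∀ x : ↥((W.baseChange K).geomPrimaryTorsion p), ∃ x' : ↥((W.baseChange K).geomPrimaryTorsion p), p • x' = x) ∧
        -- (U)
        (∀ w : HeightOneSpectrum (𝓞 K), w ∉ (↑Sf : Set (HeightOneSpectrum (𝓞 K))) → ((p : ℕ) : 𝓞 K) ∉ w.asIdeal →
          Function.Injective (resH1Hom (ContinuousMonoidHom.id (inertiaIn κ.kerSubgroup w)) Φ.incl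
            (fun g m ↦ Φ.incl_smul ((g : decomp (K := K) w) : absoluteGaloisGroup K) m))) ∧
        (∀ w : HeightOneSpectrum (𝓞 K), w ∉ (↑Sf : Set (HeightOneSpectrum (𝓞 K))) → ((p : ℕ) : 𝓞 K) ∉ w.asIdeal →
          Function.Injective (resH1Hom (ContinuousMonoidHom.id (inertiaIn κ.kerSubgroup w)) j₁
            (fun g m ↦ hj₁ ((g : decomp (K := K) w) : absoluteGaloisGroup K) m))) ∧
        (∀ w : HeightOneSpectrum (𝓞 K), w ∉ (↑Sf : Set (HeightOneSpectrum (𝓞 K))) → ((p : ℕ) : 𝓞 K) ∉ w.asIdeal →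
          Function.Injective (resH1Hom (ContinuousMonoidHom.id (inertiaIn κ.kerSubgroup w)) (AddSubgroup.inclusion (geomTorsion_le_geomPrimaryTorsion (W.baseChange K) p))
            (fun (g : inertiaIn κ.kerSubgroup w) (m : ↥((W.baseChange K).geomTorsion (p : ℤ))) ↦
              (rfl : (AddSubgroup.inclusion (geomTorsion_le_geomPrimaryTorsion (W.baseChange K) p)) (((g : decomp (K := K) w) : absoluteGaloisGroup K) • m) =
                ((g : decomp (K := K) w) : absoluteGaloisGroup K) • (AddSubgroup.inclusion (geomTorsion_le_geomPrimaryTorsion (W.baseChange K) p)) m)))) ∧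
        (∀ w : HeightOneSpectrum (𝓞 K), w ∉ (↑Sf : Set (HeightOneSpectrum (𝓞 K))) → ((p : ℕ) : 𝓞 K) ∉ w.asIdeal →
          Function.Injective (resH1Hom (ContinuousMonoidHom.id (inertiaIn κ.kerSubgroup w)) j₃
            (fun g m ↦ hj₃ ((g : decomp (K := K) w) : absoluteGaloisGroup K) m))) ∧
        -- SUR
        (∀ y : Fin (p ^ c) → subgroupH1 (κ.kerSubgroup ⊓ decomp vbar) (charModule ∅ θsub), ∃ u ∈ unramifiedOutside κ.kerSubgroup (charModule ∅ θsub) p (↑Sf : Set (HeightOneSpectrum (𝓞 K))),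
          ∀ i : Fin (p ^ c), resOfLe (charModule ∅ θsub) (inf_le_left : κ.kerSubgroup ⊓ decomp vbar ≤ κ.kerSubgroup) (conjH1 κ.kerSubgroup (charModule ∅ θsub) (τ i) u) = y i) ∧
        (∀ y : Fin (p ^ c) → subgroupH1 (κ.kerSubgroup ⊓ decomp vbar) ↥((W.baseChange K).geomPrimaryTorsion p), ∃ u ∈ unramifiedOutside κ.kerSubgroup ↥((W.baseChange K).geomPrimaryTorsion p) p (↑Sf : Set (HeightOneSpectrum (𝓞 K))),
          ∀ i : Fin (p ^ c), resOfLe ↥((W.baseChange K).geomPrimaryTorsion p) (inf_le_left : κ.kerSubgroup ⊓ decomp vbar ≤ κ.kerSubgroup) (conjH1 κ.kerSubgroup ↥((W.baseChange K).geomPrimaryTorsion p) (τ i) u) = y i) ∧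
        (∀ y : Fin (p ^ c) → subgroupH1 (κ.kerSubgroup ⊓ decomp vbar) (charModule ∅ θquot), ∃ u ∈ unramifiedOutside κ.kerSubgroup (charModule ∅ θquot) p (↑Sf : Set (HeightOneSpectrum (𝓞 K))),
          ∀ i : Fin (p ^ c), resOfLe (charModule ∅ θquot) (inf_le_left : κ.kerSubgroup ⊓ decomp vbar ≤ κ.kerSubgroup) (conjH1 κ.kerSubgroup (charModule ∅ θquot) (τ i) u) = y i) ∧
        -- COT
        (∀ s : (datumStrictSelmer κ.kerSubgroup (charModule ∅ θsub) p (AcSelmer.bdpData (charModule ∅ θsub) p vbar) (↑Sf : Set (HeightOneSpectrum (𝓞 K)))), ∃ n : ℕ, p ^ n • s = 0) ∧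
        (∀ s : (datumStrictSelmer κ.kerSubgroup ↥((W.baseChange K).geomPrimaryTorsion p) p (AcSelmer.bdpData ↥((W.baseChange K).geomPrimaryTorsion p) p vbar) (↑Sf : Set (HeightOneSpectrum (𝓞 K)))), ∃ n : ℕ, p ^ n • s = 0) ∧
        (∀ s : (datumStrictSelmer κ.kerSubgroup (charModule ∅ θquot) p (AcSelmer.bdpData (charModule ∅ θquot) p vbar) (↑Sf : Set (HeightOneSpectrum (𝓞 K)))), ∃ n : ℕ, p ^ n • s = 0) ∧
        Finite (AddSubgroup.torsionBy (datumStrictSelmer κ.kerSubgroup (charModule ∅ θsub) p (AcSelmer.bdpData (charModule ∅ θsub) p vbar) (↑Sf : Set (HeightOneSpectrum (𝓞 K)))) (p : ℤ)) ∧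
        Finite (AddSubgroup.torsionBy (datumStrictSelmer κ.kerSubgroup ↥((W.baseChange K).geomPrimaryTorsion p) p (AcSelmer.bdpData ↥((W.baseChange K).geomPrimaryTorsion p) p vbar) (↑Sf : Set (HeightOneSpectrum (𝓞 K)))) (p : ℤ)) ∧
        Finite (AddSubgroup.torsionBy (datumStrictSelmer κ.kerSubgroup (charModule ∅ θquot) p (AcSelmer.bdpData (charModule ∅ θquot) p vbar) (↑Sf : Set (HeightOneSpectrum (𝓞 K)))) (p : ℤ)) ∧
        -- global H⁰
        (∀ x : (charModule ∅ θsub), (∀ g : ↥κ.kerSubgroup, g • x = x) → ∃ x' : (charModule ∅ θsub), (∀ g : ↥κ.kerSubgroup, g • x' = x') ∧ p • x' = x) ∧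
        (∀ x : ↥((W.baseChange K).geomPrimaryTorsion p), (∀ g : ↥κ.kerSubgroup, g • x = x) → ∃ x' : ↥((W.baseChange K).geomPrimaryTorsion p), (∀ g : ↥κ.kerSubgroup, g • x' = x') ∧ p • x' = x) ∧
        (∀ x : (charModule ∅ θquot), (∀ g : ↥κ.kerSubgroup, g • x = x) → ∃ x' : (charModule ∅ θquot), (∀ g : ↥κ.kerSubgroup, g • x' = x') ∧ p • x' = x) ∧
        (∀ n : ↥((W.baseChange K).geomTorsion (p : ℤ)), (∀ g : ↥κ.kerSubgroup, g • n = n) → n = 0) ∧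
        Finite {n : Φ.Quot // ∀ g : ↥κ.kerSubgroup, g • n = n} ∧
        Nat.card {n : Φ.Quot // ∀ g : ↥κ.kerSubgroup, g • n = n} = p ^ (if ∀ σ : absoluteGaloisGroup K, θquot σ = 1 then 1 else 0) ∧
        -- local H⁰ at `H ⊓ D_v̄`
        (∀ n : Φ.Sub, (∀ g : ↥(κ.kerSubgroup ⊓ decomp vbar), g • n = n) → n = 0) ∧
        (∀ (g : ↥(κ.kerSubgroup ⊓ decomp vbar)) (n : Φ.Quot), g • n = n) ∧
        Finite Φ.Quot ∧ Nat.card Φ.Quot = p ∧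
        (∀ x : (charModule ∅ θsub), (∀ g : ↥(κ.kerSubgroup ⊓ decomp vbar), g • x = x) → ∃ x' : (charModule ∅ θsub), (∀ g : ↥(κ.kerSubgroup ⊓ decomp vbar), g • x' = x') ∧ p • x' = x) ∧
        (∀ x : (charModule ∅ θquot), (∀ g : ↥(κ.kerSubgroup ⊓ decomp vbar), g • x = x) → ∃ x' : (charModule ∅ θquot), (∀ g : ↥(κ.kerSubgroup ⊓ decomp vbar), g • x' = x') ∧ p • x' = x) ∧
        -- H² bookkeeping
        Nat.card (↥(unramifiedOutside κ.kerSubgroup Φ.Quot p (↑Sf : Set (HeightOneSpectrum (𝓞 K)))) ⧸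
            ((unramifiedOutside κ.kerSubgroup ↥((W.baseChange K).geomTorsion (p : ℤ)) p (↑Sf : Set (HeightOneSpectrum (𝓞 K)))).map (resH1Hom (ContinuousMonoidHom.id ↥κ.kerSubgroup) Φ.proj
              (fun g b ↦ Φ.proj_smul (g : absoluteGaloisGroup K) b))).addSubgroupOf
                (unramifiedOutside κ.kerSubgroup Φ.Quot p (↑Sf : Set (HeightOneSpectrum (𝓞 K))))) *
            Nat.card (ModN (unramifiedOutside κ.kerSubgroup ↥((W.baseChange K).geomPrimaryTorsion p) p (↑Sf : Set (HeightOneSpectrum (𝓞 K)))) p) =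
          Nat.card (ModN (unramifiedOutside κ.kerSubgroup (charModule ∅ θsub) p (↑Sf : Set (HeightOneSpectrum (𝓞 K)))) p) * Nat.card (ModN (unramifiedOutside κ.kerSubgroup (charModule ∅ θquot) p (↑Sf : Set (HeightOneSpectrum (𝓞 K)))) p) := by
  intro h263 hT ha W _ _ p _ hp hgood hred hanom hlat K _ _ hK hH hHp htor ι v vbar hv hvbar hne
    κ hκ γ _ θsub θquot hpair Sf hSf hfgS htorS hμS hSsub hSquot
  have h41 : prop41_globalEulerPoincareCorank := prop41_of_tate_of_poitouTate_three_le_of_isTotallyComplex hT ha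
  exact IndexInputsShell.indexInputs_of_H2_ofTateTC h263 h41 prop42_localEulerPoincareCorank_holds
    sec5A_localH2_subsingleton_of_LOC1_holds hT W p hp hanom hlat K hK hH htor ι v vbar hv hvbar hne κ hκ γ
    θsub θquot hpair Sf hSf hfgS htorS hμS hSsub hSquot
    (fun Φ j₁ j₃ hj₁ hj₃ _ _ hj₁inj hj₃inj hr₁ hr₃ ↦ IndexInputsH2.natCard_H2_conjunct_ofTateTC
      (groupCdLE_two_of_poitouTate_tc_of_isImaginaryQuadratic ha hK) h41 prop42_localEulerPoincareCorank_holds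
      sec5A_localH2_subsingleton_of_LOC1_holds hT W hp hK hH hv
      hvbar hne κ hκ γ hpair Sf hSf hSsub hSquot Φ j₁ j₃ hj₁ hj₃ hj₁inj hj₃inj hr₁ hr₃)

end Summit.BirchSwinnertonDyer.BirchSwinnertonDyer.Theorems.GoodLatticeBDPValuePublishedFactsOfTextbookTC

end
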